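import Summits.AtomisticToContinuum.Crystallization.Theses.GappedShellCensus
import Literature.Geometry.DiscreteGeometry.DihedralAngleFraction

/-!
# Crux `GappedShellCensus.ShellTrichotomy` (stmt-AtomisticToContinuum-18070), line `Sketch` —
# stub `stub_tCornerMin`

**T-corner lower bound.**  For a "2 %-regular tetrahedron" `(0, v, a, b)` of `ℝ³` — all six of
`‖v‖, ‖a‖, ‖b‖, |va|, |vb|, |ab|` in `[0.98, 1.02]` — the dihedral angle about the spoke `0v`,
i.e. the angle between the components `perpTo v a`, `perpTo v b` of `a`, `b` orthogonal to `v`,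
is at least `arccos (81/200) ≈ 66.10°` (the true infimum is `≈ 66.42°`, attained at
`‖v‖ = 0.98`, `‖a‖ = ‖b‖ = |va| = |vb| = 1.02`, `|ab| = 0.98`).

## Proof

Write `r_v = ‖v‖`, `r_a = ‖a‖`, `r_b = ‖b‖` and `⟪v, a⟫ = x r_v r_a`, `⟪v, b⟫ = y r_v r_b`,
`⟪a, b⟫ = z r_a r_b` (normalised cosines; `⟪v, a⟫ = (r_v² + r_a² − |va|²)/2` by the polarisation
identity).  Then `‖perpTo v a‖² = r_a² (1 − x²)`, `‖perpTo v b‖² = r_b² (1 − y²)` and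
`⟪perpTo v a, perpTo v b⟫ = r_a r_b (z − x y)`, so (as `arccos` is antitone) the claim is
`200² (z − x y)² ≤ 81² (1 − x²)(1 − y²)` (here `z − x y > 0` automatically).

* Coupled windows (`tCornerMin_lower_le_cos`, `tCornerMin_cos_le_upper`): `x ≥ X(R₁)` whenever
  `R₁ ≤ r_a`, where `X(R₁) = (0.98² + R₁² − 1.02²)/(2 · 0.98 · R₁)` (smallest `r_v`, largest
  `|va|`), similarly `y ≥ X(S₁)` for `S₁ ≤ r_b`, and `z ≤ Z(R, S) = (R² + S² − 0.98²)/(2 R S)`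
  whenever `r_a ≤ R`, `r_b ≤ S`; also `x, y ≤ 0.54` and `0.44 ≤ z`.  Each is a polynomial
  inequality written as a sum of products of nonnegative factors.
* Monotone reduction (`tCornerMin_mono_step`, `tCornerMin_box_reduce`): `(z − x y)²/(1 − x²)` is
  decreasing in `x` on the window (two-point form: an explicit factorisation through `X − x`),
  likewise in `y`, and increasing in `z`; hence an upper bound follows from
  `200² (Z − X Y)² ≤ 81² (1 − X²)(1 − Y²)` for the box constants (smallest `X, Y`, largest `Z`).
* One box (and a `2 × 2` split) is too coarse, so the radii `r_a`, `r_b` are each split at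
  `0.99, 1, 1.01`; the sixteen rational certificates are checked by `norm_num` (worst value
  `0.40404 < 81/200`).
-/

noncomputable section

namespace Summit.AtomisticToContinuum.Crystallization.Theorems

open scoped RealInnerProductSpace
open Literature.Geometry.DiscreteGeometry

/-! ### Real-variable lemmas -/

/-- Two-point monotonicity of `x ↦ (z − x y)² / (1 − x²)` (decreasing): cleared of denominators,
for `x ≤ X` with `z ≥ X y`, `y ≥ X z` and `X² ≤ 1`. -/
private theorem tCornerMin_mono_step {x X y z : ℝ} (hxX : x ≤ X) (hX : X ^ 2 ≤ 1)
    (h1 : 0 ≤ z - X * y) (h2 : 0 ≤ y - X * z) :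
    (z - X * y) ^ 2 * (1 - x ^ 2) ≤ (z - x * y) ^ 2 * (1 - X ^ 2) := by
  -- adapted from `stub_tCornerMax` (`mono_step`)
  have key : (z - x * y) ^ 2 * (1 - X ^ 2) - (z - X * y) ^ 2 * (1 - x ^ 2) =
      (X - x) * (2 * (z - X * y) * (y - X * z) +
        (X - x) * (y ^ 2 * (1 - X ^ 2) + (z - X * y) ^ 2)) := by
    ring
  have hnonneg : 0 ≤ (X - x) * (2 * (z - X * y) * (y - X * z) +
      (X - x) * (y ^ 2 * (1 - X ^ 2) + (z - X * y) ^ 2)) := by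
    apply mul_nonneg (sub_nonneg.2 hxX)
    apply add_nonneg
    · exact mul_nonneg (mul_nonneg (by norm_num) h1) h2
    · exact mul_nonneg (sub_nonneg.2 hxX)
        (add_nonneg (mul_nonneg (sq_nonneg y) (sub_nonneg.2 hX)) (sq_nonneg _))
  linarith [key, hnonneg]

/-- Reduction to a box certificate (upper bound for the cosine): if `0.44 ≤ X ≤ x ≤ 0.54`,
`0.44 ≤ Y ≤ y ≤ 0.54`, `0.44 ≤ z ≤ Z ≤ 0.54` and the corner `(X, Y, Z)` satisfies
`200² (Z − X Y)² ≤ 81² (1 − X²)(1 − Y²)`, then `200² (z − x y)² ≤ 81² (1 − x²)(1 − y²)` with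
`z > x y`. -/
private theorem tCornerMin_box_reduce {x y z X Y Z : ℝ} (hX0 : 11 / 25 ≤ X) (hXx : X ≤ x)
    (hx1 : x ≤ 27 / 50) (hY0 : 11 / 25 ≤ Y) (hYy : Y ≤ y) (hy1 : y ≤ 27 / 50)
    (hz0 : 11 / 25 ≤ z) (hzZ : z ≤ Z) (hZ1 : Z ≤ 27 / 50)
    (hcert : 40000 * (Z - X * Y) ^ 2 ≤ 6561 * ((1 - X ^ 2) * (1 - Y ^ 2))) :
    0 < z - x * y ∧ 40000 * (z - x * y) ^ 2 ≤ 6561 * ((1 - x ^ 2) * (1 - y ^ 2)) := by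
  have hx0 : 11 / 25 ≤ x := hX0.trans hXx
  have hy0 : 11 / 25 ≤ y := hY0.trans hYy
  have hz1 : z ≤ 27 / 50 := hzZ.trans hZ1
  have hX1 : X ≤ 27 / 50 := hXx.trans hx1
  have hY1 : Y ≤ 27 / 50 := hYy.trans hy1
  have hxy : x * y ≤ 27 / 50 * (27 / 50) := mul_le_mul hx1 hy1 (by linarith) (by norm_num)
  have hpos : 0 < z - x * y := by linarith
  refine ⟨hpos, ?_⟩
  have h1x : 0 < 1 - x ^ 2 := by nlinarith
  have h1y : 0 < 1 - y ^ 2 := by nlinarith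
  have h1X : 0 < 1 - X ^ 2 := by nlinarith
  have h1Y : 0 < 1 - Y ^ 2 := by nlinarith
  -- step in `x`
  have hxz : x * z ≤ 27 / 50 * (27 / 50) := mul_le_mul hx1 hz1 (by linarith) (by norm_num)
  have s1 : (z - x * y) ^ 2 * (1 - X ^ 2) ≤ (z - X * y) ^ 2 * (1 - x ^ 2) :=
    tCornerMin_mono_step hXx (by nlinarith) hpos.le (by linarith)
  -- step in `y`
  have hyX : y * X ≤ 27 / 50 * (27 / 50) := mul_le_mul hy1 hX1 (by linarith) (by norm_num)
  have hyz : y * z ≤ 27 / 50 * (27 / 50) := mul_le_mul hy1 hz1 (by linarith) (by norm_num)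
  have s2 : (z - y * X) ^ 2 * (1 - Y ^ 2) ≤ (z - Y * X) ^ 2 * (1 - y ^ 2) :=
    tCornerMin_mono_step hYy (by nlinarith) (by linarith) (by linarith)
  -- step in `z`
  have hXY : X * Y ≤ 27 / 50 * (27 / 50) := mul_le_mul hX1 hY1 (by linarith) (by norm_num)
  have s3 : (z - X * Y) ^ 2 ≤ (Z - X * Y) ^ 2 :=
    pow_le_pow_left₀ (by linarith) (by linarith) 2
  have chain : 40000 * (z - x * y) ^ 2 * ((1 - X ^ 2) * (1 - Y ^ 2)) ≤
      6561 * ((1 - x ^ 2) * (1 - y ^ 2)) * ((1 - X ^ 2) * (1 - Y ^ 2)) :=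
    calc 40000 * (z - x * y) ^ 2 * ((1 - X ^ 2) * (1 - Y ^ 2))
        = 40000 * (1 - Y ^ 2) * ((z - x * y) ^ 2 * (1 - X ^ 2)) := by ring
      _ ≤ 40000 * (1 - Y ^ 2) * ((z - X * y) ^ 2 * (1 - x ^ 2)) :=
          mul_le_mul_of_nonneg_left s1 (by positivity)
      _ = 40000 * (1 - x ^ 2) * ((z - y * X) ^ 2 * (1 - Y ^ 2)) := by ring
      _ ≤ 40000 * (1 - x ^ 2) * ((z - Y * X) ^ 2 * (1 - y ^ 2)) :=
          mul_le_mul_of_nonneg_left s2 (by positivity)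
      _ = 40000 * ((1 - x ^ 2) * (1 - y ^ 2)) * (z - X * Y) ^ 2 := by ring
      _ ≤ 40000 * ((1 - x ^ 2) * (1 - y ^ 2)) * (Z - X * Y) ^ 2 :=
          mul_le_mul_of_nonneg_left s3 (by positivity)
      _ = (1 - x ^ 2) * (1 - y ^ 2) * (40000 * (Z - X * Y) ^ 2) := by ring
      _ ≤ (1 - x ^ 2) * (1 - y ^ 2) * (6561 * ((1 - X ^ 2) * (1 - Y ^ 2))) :=
          mul_le_mul_of_nonneg_left hcert (by positivity)
      _ = 6561 * ((1 - x ^ 2) * (1 - y ^ 2)) * ((1 - X ^ 2) * (1 - Y ^ 2)) := by ring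
  exact le_of_mul_le_mul_right chain (mul_pos h1X h1Y)

/-- Coupled upper window for a normalised cosine: for radii `r ∈ [0.98, R]`, `s ∈ [0.98, S]`
(`R, S ≤ 1.02`) and a distance `d ≥ 0.98`,
`(r² + s² − d²)/2 ≤ Z(R, S) · r s` with `Z(R, S) = (R² + S² − 0.98²)/(2 R S)`. -/
private theorem tCornerMin_cos_le_upper {r s d R S : ℝ} (hr1 : 1 - 1 / 50 ≤ r) (hrR : r ≤ R)
    (hR2 : R ≤ 1 + 1 / 50) (hs1 : 1 - 1 / 50 ≤ s) (hsS : s ≤ S) (hS2 : S ≤ 1 + 1 / 50)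
    (hd : 1 - 1 / 50 ≤ d) :
    (r ^ 2 + s ^ 2 - d ^ 2) / 2 ≤
      (R ^ 2 + S ^ 2 - (1 - 1 / 50) ^ 2) / (2 * R * S) * (r * s) := by
  have hR : 0 < R := by linarith
  have hS : 0 < S := by linarith
  have hd2 : (1 - 1 / 50) ^ 2 ≤ d ^ 2 := pow_le_pow_left₀ (by norm_num) hd 2
  have hsS' : (1 - 1 / 50) * (1 - 1 / 50) ≤ s * S :=
    mul_le_mul hs1 (hs1.trans hsS) (by norm_num) (by linarith)
  have hrR' : (1 - 1 / 50) * (1 - 1 / 50) ≤ R * r :=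
    mul_le_mul (hr1.trans hrR) hr1 (by norm_num) hR.le
  have hR2' : R ^ 2 ≤ (1 + 1 / 50) ^ 2 := pow_le_pow_left₀ hR.le hR2 2
  have hs2' : s ^ 2 ≤ (1 + 1 / 50) ^ 2 := pow_le_pow_left₀ (by linarith) (hsS.trans hS2) 2
  have h1 : 0 ≤ R * S * (d ^ 2 - (1 - 1 / 50) ^ 2) :=
    mul_nonneg (by positivity) (sub_nonneg.2 hd2)
  have h2 : 0 ≤ r * ((S - s) * (s * S - R ^ 2 + (1 - 1 / 50) ^ 2)) :=
    mul_nonneg (by linarith) (mul_nonneg (sub_nonneg.2 hsS) (by linarith))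
  have h3 : 0 ≤ S * ((R - r) * (R * r - s ^ 2 + (1 - 1 / 50) ^ 2)) :=
    mul_nonneg hS.le (mul_nonneg (sub_nonneg.2 hrR) (by linarith))
  rw [div_mul_eq_mul_div, le_div_iff₀ (by positivity)]
  have key : (R ^ 2 + S ^ 2 - (1 - 1 / 50) ^ 2) * (r * s) -
      (r ^ 2 + s ^ 2 - d ^ 2) / 2 * (2 * R * S) =
      R * S * (d ^ 2 - (1 - 1 / 50) ^ 2) + r * ((S - s) * (s * S - R ^ 2 + (1 - 1 / 50) ^ 2)) +
        S * ((R - r) * (R * r - s ^ 2 + (1 - 1 / 50) ^ 2)) := by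
    ring
  linarith [key, h1, h2, h3]

/-- Coupled lower window for a normalised cosine: for radii `r ∈ [R₁, 1.02]`, `s ∈ [S₁, 1.02]`
(`R₁, S₁ ≥ 0.98`) and a distance `d ≤ 1.02`,
`Z(R₁, S₁) · r s ≤ (r² + s² − d²)/2` with `Z(R₁, S₁) = (R₁² + S₁² − 1.02²)/(2 R₁ S₁)`. -/
private theorem tCornerMin_lower_le_cos {r s d R₁ S₁ : ℝ} (hR₁ : 1 - 1 / 50 ≤ R₁) (hr1 : R₁ ≤ r)
    (hr2 : r ≤ 1 + 1 / 50) (hS₁ : 1 - 1 / 50 ≤ S₁) (hs1 : S₁ ≤ s) (hs2 : s ≤ 1 + 1 / 50)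
    (hd0 : 0 ≤ d) (hd : d ≤ 1 + 1 / 50) :
    (R₁ ^ 2 + S₁ ^ 2 - (1 + 1 / 50) ^ 2) / (2 * R₁ * S₁) * (r * s) ≤
      (r ^ 2 + s ^ 2 - d ^ 2) / 2 := by
  -- adapted from `stub_tCornerMax` (`lower_le_cos`)
  have hR : 0 < R₁ := by linarith
  have hS : 0 < S₁ := by linarith
  have hd2 : d ^ 2 ≤ (1 + 1 / 50) ^ 2 := pow_le_pow_left₀ hd0 hd 2
  have hs2' : s ^ 2 ≤ (1 + 1 / 50) ^ 2 := pow_le_pow_left₀ (by linarith) hs2 2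
  have hr2' : R₁ ^ 2 ≤ (1 + 1 / 50) ^ 2 := pow_le_pow_left₀ hR.le (hr1.trans hr2) 2
  have h1 : 0 ≤ R₁ * S₁ * ((1 + 1 / 50) ^ 2 - d ^ 2) :=
    mul_nonneg (by positivity) (sub_nonneg.2 hd2)
  have h2 : 0 ≤ S₁ * ((r - R₁) * (r * R₁ + (1 + 1 / 50) ^ 2 - s ^ 2)) :=
    mul_nonneg hS.le (mul_nonneg (by linarith) (by nlinarith))
  have h3 : 0 ≤ r * ((s - S₁) * (s * S₁ + (1 + 1 / 50) ^ 2 - R₁ ^ 2)) :=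
    mul_nonneg (by linarith) (mul_nonneg (by linarith) (by nlinarith))
  rw [div_mul_eq_mul_div, div_le_iff₀ (by positivity), div_mul_eq_mul_div,
    le_div_iff₀ (by norm_num : (0 : ℝ) < 2)]
  have key : (r ^ 2 + s ^ 2 - d ^ 2) * (2 * R₁ * S₁) -
      (R₁ ^ 2 + S₁ ^ 2 - (1 + 1 / 50) ^ 2) * (r * s) * 2 =
      2 * (R₁ * S₁ * ((1 + 1 / 50) ^ 2 - d ^ 2) +
        S₁ * ((r - R₁) * (r * R₁ + (1 + 1 / 50) ^ 2 - s ^ 2)) +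
        r * ((s - S₁) * (s * S₁ + (1 + 1 / 50) ^ 2 - R₁ ^ 2))) := by
    ring
  linarith [key, h1, h2, h3]

/-- Splitting the radius range `[0.98, 1.02]` into four at `0.99, 1, 1.01`. -/
private theorem tCornerMin_four_split {t : ℝ} (h1 : 1 - 1 / 50 ≤ t) (h2 : t ≤ 1 + 1 / 50) :
    (1 - 1 / 50 ≤ t ∧ t ≤ 99 / 100) ∨ (99 / 100 ≤ t ∧ t ≤ 1) ∨ (1 ≤ t ∧ t ≤ 101 / 100) ∨
      (101 / 100 ≤ t ∧ t ≤ 1 + 1 / 50) := by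
  rcases le_total t (99 / 100) with h | h
  · exact Or.inl ⟨h1, h⟩
  rcases le_total t 1 with h' | h'
  · exact Or.inr (Or.inl ⟨h, h'⟩)
  rcases le_total t (101 / 100) with h'' | h''
  · exact Or.inr (Or.inr (Or.inl ⟨h', h''⟩))
  · exact Or.inr (Or.inr (Or.inr ⟨h'', h2⟩))

/-! ### The T-corner lower bound -/

/-- **T-corner lower bound (coupled).**  For `v, a, b ∈ ℝ³` with all of `‖v‖, ‖a‖, ‖b‖,
dist v a, dist v b, dist a b` in `[0.98, 1.02]`, the dihedral angle about the spoke `0v` of the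
tetrahedron `(0, v, a, b)` — the angle between the components of `a` and `b` orthogonal to `v` —
is at least `arccos (81/200) ≈ 66.10°`. -/
theorem stub_tCornerMin (v a b : EuclideanSpace ℝ (Fin 3))
    (hv : 1 - 1 / 50 ≤ ‖v‖ ∧ ‖v‖ ≤ 1 + 1 / 50) (ha : 1 - 1 / 50 ≤ ‖a‖ ∧ ‖a‖ ≤ 1 + 1 / 50)
    (hb : 1 - 1 / 50 ≤ ‖b‖ ∧ ‖b‖ ≤ 1 + 1 / 50)
    (hva : 1 - 1 / 50 ≤ dist v a ∧ dist v a ≤ 1 + 1 / 50) (hvb : 1 - 1 / 50 ≤ dist v b ∧ dist v b ≤ 1 + 1 / 50)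
    (hab : 1 - 1 / 50 ≤ dist a b ∧ dist a b ≤ 1 + 1 / 50) :
    Real.arccos (81 / 200) ≤ InnerProductGeometry.angle (perpTo v a) (perpTo v b) := by
  -- radii, Gram entries
  have hrv : 0 < ‖v‖ := by linarith [hv.1]
  have hra : 0 < ‖a‖ := by linarith [ha.1]
  have hrb : 0 < ‖b‖ := by linarith [hb.1]
  have hv0 : v ≠ 0 := norm_pos_iff.1 hrv
  have hvv : ⟪v, v⟫ = ‖v‖ ^ 2 := real_inner_self_eq_norm_sq v
  have haa : ⟪a, a⟫ = ‖a‖ ^ 2 := real_inner_self_eq_norm_sq a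
  have hbb : ⟪b, b⟫ = ‖b‖ ^ 2 := real_inner_self_eq_norm_sq b
  have gva : ⟪v, a⟫ = (‖v‖ ^ 2 + ‖a‖ ^ 2 - dist v a ^ 2) / 2 := by
    rw [dist_eq_norm, norm_sub_sq_real]; ring
  have gvb : ⟪v, b⟫ = (‖v‖ ^ 2 + ‖b‖ ^ 2 - dist v b ^ 2) / 2 := by
    rw [dist_eq_norm, norm_sub_sq_real]; ring
  have gab : ⟪a, b⟫ = (‖a‖ ^ 2 + ‖b‖ ^ 2 - dist a b ^ 2) / 2 := by
    rw [dist_eq_norm, norm_sub_sq_real]; ring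
  -- normalised cosines
  obtain ⟨x, hx⟩ : ∃ x : ℝ, ⟪v, a⟫ = x * (‖v‖ * ‖a‖) :=
    ⟨⟪v, a⟫ / (‖v‖ * ‖a‖), (div_mul_cancel₀ _ (mul_pos hrv hra).ne').symm⟩
  obtain ⟨y, hy⟩ : ∃ y : ℝ, ⟪v, b⟫ = y * (‖v‖ * ‖b‖) :=
    ⟨⟪v, b⟫ / (‖v‖ * ‖b‖), (div_mul_cancel₀ _ (mul_pos hrv hrb).ne').symm⟩
  obtain ⟨z, hz⟩ : ∃ z : ℝ, ⟪a, b⟫ = z * (‖a‖ * ‖b‖) :=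
    ⟨⟪a, b⟫ / (‖a‖ * ‖b‖), (div_mul_cancel₀ _ (mul_pos hra hrb).ne').symm⟩
  -- the projections in terms of `x, y, z`
  have hPaa : ⟪perpTo v a, perpTo v a⟫ = ‖a‖ ^ 2 * (1 - x ^ 2) := by
    rw [inner_perpTo_self hv0, haa, hx, hvv]
    field_simp
  have hPbb : ⟪perpTo v b, perpTo v b⟫ = ‖b‖ ^ 2 * (1 - y ^ 2) := by
    rw [inner_perpTo_self hv0, hbb, hy, hvv]
    field_simp
  have hPab : ⟪perpTo v a, perpTo v b⟫ = ‖a‖ * ‖b‖ * (z - x * y) := by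
    have h : ⟪perpTo v a, perpTo v b⟫ = ⟪a, b⟫ - ⟪v, a⟫ / ⟪v, v⟫ * ⟪v, b⟫ := by
      conv_lhs => rw [perpTo_def v b]
      rw [inner_sub_right, real_inner_smul_right, inner_perpTo_left, mul_zero, sub_zero,
        perpTo_def, inner_sub_left, real_inner_smul_left]
    rw [h, hz, hx, hy, hvv]
    field_simp
  -- windows for `x, y, z`
  have hd0 : ∀ p q : EuclideanSpace ℝ (Fin 3), 0 ≤ dist p q := fun p q => dist_nonneg
  have hx1 : x ≤ 27 / 50 := by
    have h := tCornerMin_cos_le_upper hv.1 hv.2 le_rfl ha.1 ha.2 le_rfl hva.1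
    rw [← gva, hx] at h
    exact le_trans (le_of_mul_le_mul_right h (mul_pos hrv hra)) (by norm_num)
  have hy1 : y ≤ 27 / 50 := by
    have h := tCornerMin_cos_le_upper hv.1 hv.2 le_rfl hb.1 hb.2 le_rfl hvb.1
    rw [← gvb, hy] at h
    exact le_trans (le_of_mul_le_mul_right h (mul_pos hrv hrb)) (by norm_num)
  have hz0 : 11 / 25 ≤ z := by
    have h := tCornerMin_lower_le_cos (le_refl (1 - 1 / 50 : ℝ)) ha.1 ha.2
      (le_refl (1 - 1 / 50 : ℝ)) hb.1 hb.2 (hd0 a b) hab.2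
    rw [← gab, hz] at h
    exact le_trans (by norm_num) (le_of_mul_le_mul_right h (mul_pos hra hrb))
  have hXx : ∀ R₁ : ℝ, 1 - 1 / 50 ≤ R₁ → R₁ ≤ ‖a‖ →
      ((1 - 1 / 50) ^ 2 + R₁ ^ 2 - (1 + 1 / 50) ^ 2) / (2 * (1 - 1 / 50) * R₁) ≤ x := by
    intro R₁ hR₁ hR₁a
    have h := tCornerMin_lower_le_cos (le_refl (1 - 1 / 50 : ℝ)) hv.1 hv.2 hR₁ hR₁a ha.2
      (hd0 v a) hva.2
    rw [← gva, hx] at h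
    exact le_of_mul_le_mul_right h (mul_pos hrv hra)
  have hYy : ∀ S₁ : ℝ, 1 - 1 / 50 ≤ S₁ → S₁ ≤ ‖b‖ →
      ((1 - 1 / 50) ^ 2 + S₁ ^ 2 - (1 + 1 / 50) ^ 2) / (2 * (1 - 1 / 50) * S₁) ≤ y := by
    intro S₁ hS₁ hS₁b
    have h := tCornerMin_lower_le_cos (le_refl (1 - 1 / 50 : ℝ)) hv.1 hv.2 hS₁ hS₁b hb.2
      (hd0 v b) hvb.2
    rw [← gvb, hy] at h
    exact le_of_mul_le_mul_right h (mul_pos hrv hrb)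
  have hzZ : ∀ R S : ℝ, ‖a‖ ≤ R → R ≤ 1 + 1 / 50 → ‖b‖ ≤ S → S ≤ 1 + 1 / 50 →
      z ≤ (R ^ 2 + S ^ 2 - (1 - 1 / 50) ^ 2) / (2 * R * S) := by
    intro R S hR hR2 hS hS2
    have h := tCornerMin_cos_le_upper ha.1 hR hR2 hb.1 hS hS2 hab.1
    rw [← gab, hz] at h
    exact le_of_mul_le_mul_right h (mul_pos hra hrb)
  -- the sixteen boxes
  obtain ⟨hpos, hineq⟩ :
      0 < z - x * y ∧ 40000 * (z - x * y) ^ 2 ≤ 6561 * ((1 - x ^ 2) * (1 - y ^ 2)) := by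
    rcases tCornerMin_four_split ha.1 ha.2 with ⟨h1, h2⟩ | ⟨h1, h2⟩ | ⟨h1, h2⟩ | ⟨h1, h2⟩ <;>
    rcases tCornerMin_four_split hb.1 hb.2 with ⟨h3, h4⟩ | ⟨h3, h4⟩ | ⟨h3, h4⟩ | ⟨h3, h4⟩ <;>
    exact tCornerMin_box_reduce (by norm_num) (hXx _ (by norm_num) h1) hx1 (by norm_num)
      (hYy _ (by norm_num) h3) hy1 hz0 (hzZ _ _ h2 (by norm_num) h4 (by norm_num)) (by norm_num)
      (by norm_num)
  -- conclusion
  have hx2 : x ^ 2 < 1 := by nlinarith [hXx _ le_rfl ha.1]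
  have hy2 : y ^ 2 < 1 := by nlinarith [hYy _ le_rfl hb.1]
  have hna : 0 < ‖perpTo v a‖ := by
    refine norm_pos_iff.2 (real_inner_self_pos.1 ?_)
    rw [hPaa]
    exact mul_pos (pow_pos hra 2) (by linarith)
  have hnb : 0 < ‖perpTo v b‖ := by
    refine norm_pos_iff.2 (real_inner_self_pos.1 ?_)
    rw [hPbb]
    exact mul_pos (pow_pos hrb 2) (by linarith)
  have h200pos : 0 ≤ 200 * ⟪perpTo v a, perpTo v b⟫ := by
    rw [hPab]
    exact mul_nonneg (by norm_num) (mul_nonneg (mul_nonneg hra.le hrb.le) hpos.le)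
  have hsq : (200 * ⟪perpTo v a, perpTo v b⟫) ^ 2 ≤ (81 * (‖perpTo v a‖ * ‖perpTo v b‖)) ^ 2 := by
    have hna2 : ‖perpTo v a‖ ^ 2 = ‖a‖ ^ 2 * (1 - x ^ 2) := by
      rw [← real_inner_self_eq_norm_sq, hPaa]
    have hnb2 : ‖perpTo v b‖ ^ 2 = ‖b‖ ^ 2 * (1 - y ^ 2) := by
      rw [← real_inner_self_eq_norm_sq, hPbb]
    have h := mul_le_mul_of_nonneg_left hineq (by positivity : (0 : ℝ) ≤ ‖a‖ ^ 2 * ‖b‖ ^ 2)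
    calc (200 * ⟪perpTo v a, perpTo v b⟫) ^ 2
        = ‖a‖ ^ 2 * ‖b‖ ^ 2 * (40000 * (z - x * y) ^ 2) := by rw [hPab]; ring
      _ ≤ ‖a‖ ^ 2 * ‖b‖ ^ 2 * (6561 * ((1 - x ^ 2) * (1 - y ^ 2))) := h
      _ = 81 ^ 2 * (‖perpTo v a‖ ^ 2 * ‖perpTo v b‖ ^ 2) := by rw [hna2, hnb2]; ring
      _ = (81 * (‖perpTo v a‖ * ‖perpTo v b‖)) ^ 2 := by ring
  have h81 : 200 * ⟪perpTo v a, perpTo v b⟫ ≤ 81 * (‖perpTo v a‖ * ‖perpTo v b‖) :=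
    (pow_le_pow_iff_left₀ h200pos (by positivity) two_ne_zero).1 hsq
  unfold InnerProductGeometry.angle
  apply Real.arccos_le_arccos
  rw [div_le_iff₀ (mul_pos hna hnb)]
  linarith

end Summit.AtomisticToContinuum.Crystallization.Theorems
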